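import Summits.Ventures.LatticeQCDFlow.Exactness.ReversibleNeumannSums
import HarnessLib

/-!
# The VARIATIONAL (Dirichlet-principle) floor of a reversible sampler: `(∫ g v w)² ≤ A_r(g) · Q_r(v)`, hence `τ_int(g) ≥ ⟨g, v⟩² / (C_g(0) 𝓔(v)) − ½` for EVERY trial observable `v`

HONEST FRAMING: exact (Metropolis-corrected) sampling algorithms for lattice gauge theory;
figures of merit are autocorrelation/cost numbers at stated couplings and volumes; no
continuum-physics claim.  (SCALAR calibration rung S0-A: not a gauge result.)

Venture `LatticeQCDFlow` (cell pub-lqcd), topic `Exactness`; FANOUT row 2 (`s0-phi4`).  NEW WORK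
of the cell over `Exactness/ReversibleOperatorL2.lean` / `ReversibleNeumannSums.lean` (the format `RevOp` of a
reversible exact sampler: weight `w ≥ 0`, class `A`, operator `K` with (int) (comb) (stab) (lin)
(symm) (contr)); only limits of real sequences are used (no spectral theorem, no resolvent).
Nothing is cited as a fact.  Printed counterparts, NAMED ONLY: the variational (`H₋₁`) formula
for the asymptotic variance of a reversible Markov chain,
`Σ_{k∈ℤ} C_g(k) = 2 sup_v [2⟨g, v⟩ − ⟨v, (I − K) v⟩] − ⟨g, g⟩` (Kipnis–Varadhan 1986, Comm. Math.
Phys. 104), and the trial-observable lower bounds on autocorrelation times of reversible dynamics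
of Caracciolo–Pelissetto–Sokal 1990 (J. Stat. Phys. 60); Madras–Slade 1993 Prop. 9.2.2 is the
trial observable `v = g`.  The tree had the test-function side of the formula for the FLOW arm only
(`Exactness/IMHVariationalPrinciple.lean`, row 4, under summability); here it is proved for EVERY
reversible sampler in the `RevOp` format (row 2's HMC `hmcOpOf`/`hmcOpPhi4`, the random-site-scan
Metropolis `metroScan`, the flow sampler, the randomised HMC `hmcOpRandom`, all instances already in
the tree) and — the cell's point — in an ABEL-REGULARISED form that needs NO summability and NO
`ρ(1) < 1` hypothesis.

## Setting and notation

`g, v ∈ A`; `C_g(k) = ∫ g (Kᵏ g) w` (stationary autocovariances, `C_g(0) = ∫ g² w`);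
for `0 ≤ r < 1` the ABEL SUM `A_r(g) = Σ_{k≥0} C_g(k) rᵏ` (absolutely convergent: `|C_g(k)| ≤ C_g(0)`)
and the regularised Dirichlet form `Q_r(v) = ∫ v² w − r ∫ v (K v) w = (1 − r) ∫ v² w + r 𝓔(v)`,
`𝓔(v) = ∫ v² w − ∫ v (K v) w = C_v(0) − C_v(1)`; `τ_int` in the Madras–Sokal convention
(`Scoring.tauInt`, `τ_int = ½ + Σ_{k≥1} ρ(k)`, `ρ(k) = C_g(k)/C_g(0)`).

## What is proved (namespace `RevOp`)

(toolbox in `Exactness/ReversibleNeumannSums.lean`: `|C_g(m)| ≤ C_g(0)`, `Q_r ≥ 0`, the partial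
Neumann sums `S_N = Σ_{k<N} rᵏ Kᵏ g ∈ A` with `S_N − r K S_N = g − r^N K^N g`, and the
Cauchy–Schwarz inequality `(∫ f v w − r ∫ (Kf) v w)² ≤ Q_r(f) Q_r(v)`)

* **`sq_inner_le_abelSum_mul_quadForm`** — THE VARIATIONAL FLOOR, Abel form, unconditional:
  for `0 ≤ r < 1` and every `g, v ∈ A`, **`(∫ g v w)² ≤ A_r(g) · Q_r(v)`**.
  Proof: `sq_rInner_le` at `f = S_N` reads `(⟨g, v⟩ − r^N ⟨K^N g, v⟩)² ≤ (Σ_{k<N} rᵏ C_g(k) −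
  r^N Σ_{k<N} rᵏ C_g(N+k)) · Q_r(v)` by the resolvent identity, symmetry and the two-time form;
  let `N → ∞` (`|⟨K^N g, v⟩|`, `|C_g(·)|` bounded, `N r^N → 0`).
* `abelSum_autocorr_ge_variational` — normalised: `Σ_k ρ(k) rᵏ ≥ ⟨g, v⟩²/(C_g(0) Q_r(v))`;
  `abelSum_autocorr_ge` — the trial observable `v = g`: **`Σ_k ρ(k) rᵏ ≥ 1/(1 − r ρ(1))`** for every
  `0 ≤ r < 1` (Madras–Slade's floor in Abel form: NO summability, NO `ρ(1) < 1`; as `r ↑ 1` the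
  right side tends to `1/(1 − ρ(1)) = (1 + ρ(1))/(2(1 − ρ(1))) + ½`, i.e. the `τ_int + ½` of
  `RevOp.tauInt_ge`).

The `τ_int` form under summability (`τ_int(g) ≥ ⟨g, v⟩²/(C_g(0) 𝓔(v)) − ½`, by Abel's theorem)
and the FROZEN-MODE corollary are `Exactness/ReversibleVariationalTauInt.lean`.

Reading (no numerics implied).  Every `τ_int` floor of rows C/E/G/I/J/K of HOME/s0-phi4/CSD-THEOREMS.md
and of the HMC/flow companions is the trial observable `v = g`; the new freedom is `v ≠ g`: a SLOW
trial observable `v` (small `𝓔(v)`: a phase label that rarely flips, a sticky tail indicator, a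
nearly conserved mode) forces EVERY observable `g` correlated with it to be slow,
`τ_int(g) + ½ ≥ Corr(g, v)² · (τ-floor of v + ½)`.  The lattice instances (the magnetisation ITSELF
inherits the tunnelling floors of `sgn M` under all three arms; the HMC no-spectral-gap theorem
without its summability caveat) are separate files.  NOT CLAIMED: the equality (supremum attained,
which needs the Poisson equation / resolvent in the class); non-reversible updates (ordered sweeps),
for which no such floor holds; any number for any run.
-/

namespace Summit.Ventures.LatticeQCDFlow.Exactness

open Real MeasureTheory Filter Finset Topology
open Summit.Ventures.LatticeQCDFlow.Scoring

namespace RevOp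

variable {X : Type*} [MeasurableSpace X] {μ : Measure X} {w : X → ℝ} {A : (X → ℝ) → Prop}
  {K : (X → ℝ) → (X → ℝ)}

/-! ## The variational floor in Abel form -/

/-- **THE VARIATIONAL FLOOR OF A REVERSIBLE SAMPLER (Abel form, unconditional).**  For
`0 ≤ r < 1` and every `g, v ∈ A`:
`(∫ g v w)² ≤ (Σ_{k≥0} C_g(k) rᵏ) · (∫ v² w − r ∫ v (K v) w)`, `C_g(k) = ∫ g (Kᵏ g) w`.
No summability, no `ρ(1) < 1`, no spectral theorem: the partial Neumann sums as test observables
in the Cauchy–Schwarz inequality of `Q_r`, and `N → ∞`. -/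
theorem sq_inner_le_abelSum_mul_quadForm (hw0 : ∀ x, 0 ≤ w x)
    (hAi : ∀ ⦃f h : X → ℝ⦄, A f → A h → Integrable (fun x => f x * h x * w x) μ)
    (hAc : ∀ ⦃f h : X → ℝ⦄ (c : ℝ), A f → A h → A (fun x => f x + c * h x))
    (hAK : ∀ ⦃f : X → ℝ⦄, A f → A (K f))
    (hlin : ∀ ⦃f h : X → ℝ⦄ (c : ℝ), A f → A h →
      ∀ x, K (fun s => f s + c * h s) x = K f x + c * K h x)
    (hsymm : ∀ ⦃f h : X → ℝ⦄, A f → A h →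
      ∫ x, K f x * h x * w x ∂μ = ∫ x, f x * K h x * w x ∂μ)
    (hcontr : ∀ ⦃f : X → ℝ⦄, A f → ∫ x, K f x ^ 2 * w x ∂μ ≤ ∫ x, f x ^ 2 * w x ∂μ)
    {g v : X → ℝ} (hg : A g) (hv : A v) {r : ℝ} (hr0 : 0 ≤ r) (hr1 : r < 1) :
    (∫ x, g x * v x * w x ∂μ) ^ 2
      ≤ (∑' k, (∫ x, g x * (K^[k] g) x * w x ∂μ) * r ^ k)
        * ((∫ x, v x ^ 2 * w x ∂μ) - r * ∫ x, v x * K v x * w x ∂μ) := by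
  -- notation
  set C : ℕ → ℝ := fun k => ∫ x, g x * (K^[k] g) x * w x ∂μ with hC
  set P := ∫ x, g x ^ 2 * w x ∂μ with hP
  set D := ∫ x, v x ^ 2 * w x ∂μ with hD
  set Q := (∫ x, v x ^ 2 * w x ∂μ) - r * ∫ x, v x * K v x * w x ∂μ with hQ
  set I : ℕ → ℝ := fun N => ∫ x, (K^[N] g) x * v x * w x ∂μ with hI
  have hP0 : 0 ≤ P := integral_nonneg fun x => mul_nonneg (sq_nonneg _) (hw0 x)
  have hD0 : 0 ≤ D := integral_nonneg fun x => mul_nonneg (sq_nonneg _) (hw0 x)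
  have hQ0 : 0 ≤ Q := quadForm_nonneg hw0 hAi hAK hcontr hv hr0 hr1.le
  have hCabs : ∀ k, |C k| ≤ P := fun k => abs_autocov_le hw0 hAi hAK hcontr hg k
  have hI0 : I 0 = ∫ x, g x * v x * w x ∂μ := by simp [hI]
  -- `|I N| ≤ √(P D)`
  have hIabs : ∀ N, |I N| ≤ Real.sqrt (P * D) := by
    intro N
    have hgN := iterate_mem hAK N hg
    have hCS := sq_integral_mul_le hw0 hAi hgN hv
    have hc := iterate_contr hAK hcontr N hg
    refine Real.abs_le_sqrt ?_
    calc (I N) ^ 2 ≤ (∫ x, (K^[N] g) x ^ 2 * w x ∂μ) * D := hCS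
      _ ≤ P * D := mul_le_mul_of_nonneg_right hc hD0
  -- the `N`-th inequality
  have hstep : ∀ N : ℕ, (I 0 - r ^ N * I N) ^ 2
      ≤ ((∑ k ∈ Finset.range N, C k * r ^ k) - r ^ N * ∑ k ∈ Finset.range N, C (N + k) * r ^ k)
        * Q := by
    intro N
    have hS := neumann_mem hAc hAK hg r N
    have hgN := iterate_mem hAK N hg
    have h := sq_rInner_le hw0 hAi hAc hAK hlin hsymm hcontr hS hv hr0 hr1.le
    -- the `B`-term: `∫ S v w − r ∫ (K S) v w = I 0 − r^N I N`
    have hB1 : ∫ x, (∑ k ∈ Finset.range N, r ^ k * (K^[k] g) x) * v x * w x ∂μ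
        = ∑ k ∈ Finset.range N, r ^ k * I k :=
      integral_sum_mul hAi (fun k => iterate_mem hAK k hg) hv (fun k => r ^ k) N
    have hB2 : ∫ x, K (fun y => ∑ k ∈ Finset.range N, r ^ k * (K^[k] g) y) x * v x * w x ∂μ
        = ∑ k ∈ Finset.range N, r ^ k * I (k + 1) := by
      have e : ∀ x, K (fun y => ∑ k ∈ Finset.range N, r ^ k * (K^[k] g) y) x * v x * w x
          = (∑ k ∈ Finset.range N, r ^ k * (K^[k + 1] g) x) * v x * w x := by
        intro x; rw [op_neumann hAc hAK hlin hg r N x]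
      simp_rw [e]
      exact integral_sum_mul hAi (fun k => iterate_mem hAK (k + 1) hg) hv (fun k => r ^ k) N
    have hB : (∫ x, (∑ k ∈ Finset.range N, r ^ k * (K^[k] g) x) * v x * w x ∂μ)
        - r * ∫ x, K (fun y => ∑ k ∈ Finset.range N, r ^ k * (K^[k] g) y) x * v x * w x ∂μ
        = I 0 - r ^ N * I N := by
      rw [hB1, hB2, Finset.mul_sum]
      have e : ∀ k ∈ Finset.range N, r * (r ^ k * I (k + 1)) = r ^ (k + 1) * I (k + 1) := by
        intro k _; ring
      rw [Finset.sum_congr rfl e, ← Finset.sum_sub_distrib,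
        Finset.sum_range_sub' (fun k => r ^ k * I k) N]
      simp
    -- the `Q(S)`-term: `∫ S² w − r ∫ S (K S) w = Σ rᵏ C k − r^N Σ rᵏ C (N + k)`
    have iSg := hAi hS hg
    have iSN := hAi hS hgN
    have hQS : (∫ x, (∑ k ∈ Finset.range N, r ^ k * (K^[k] g) x) ^ 2 * w x ∂μ)
        - r * ∫ x, (∑ k ∈ Finset.range N, r ^ k * (K^[k] g) x)
          * K (fun y => ∑ k ∈ Finset.range N, r ^ k * (K^[k] g) y) x * w x ∂μ
        = (∑ k ∈ Finset.range N, C k * r ^ k) - r ^ N * ∑ k ∈ Finset.range N, C (N + k) * r ^ k := by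
      have iS2 : Integrable (fun x => (∑ k ∈ Finset.range N, r ^ k * (K^[k] g) x) ^ 2 * w x) μ :=
        integrable_sq_mul hAi hS
      have iSKS := hAi hS (hAK hS)
      rw [← integral_const_mul, ← integral_sub iS2 (iSKS.const_mul r)]
      have e : ∀ x, (∑ k ∈ Finset.range N, r ^ k * (K^[k] g) x) ^ 2 * w x
          - r * ((∑ k ∈ Finset.range N, r ^ k * (K^[k] g) x)
            * K (fun y => ∑ k ∈ Finset.range N, r ^ k * (K^[k] g) y) x * w x)
          = (∑ k ∈ Finset.range N, r ^ k * (K^[k] g) x) * g x * w x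
            - r ^ N * ((∑ k ∈ Finset.range N, r ^ k * (K^[k] g) x) * (K^[N] g) x * w x) := by
        intro x
        have hres := neumann_sub_op hAc hAK hlin hg r N x
        have : (∑ k ∈ Finset.range N, r ^ k * (K^[k] g) x) ^ 2 * w x
            - r * ((∑ k ∈ Finset.range N, r ^ k * (K^[k] g) x)
              * K (fun y => ∑ k ∈ Finset.range N, r ^ k * (K^[k] g) y) x * w x)
            = (∑ k ∈ Finset.range N, r ^ k * (K^[k] g) x)
              * ((∑ k ∈ Finset.range N, r ^ k * (K^[k] g) x)
                - r * K (fun y => ∑ k ∈ Finset.range N, r ^ k * (K^[k] g) y) x) * w x := by ring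
        rw [this, hres]
        ring
      rw [integral_congr_ae (Eventually.of_forall e), integral_sub iSg (iSN.const_mul _),
        integral_const_mul,
        integral_sum_mul hAi (fun k => iterate_mem hAK k hg) hg (fun k => r ^ k) N,
        integral_sum_mul hAi (fun k => iterate_mem hAK k hg) hgN (fun k => r ^ k) N]
      have e1 : ∀ k ∈ Finset.range N, r ^ k * ∫ x, (K^[k] g) x * g x * w x ∂μ = C k * r ^ k := by
        intro k _
        have : ∫ x, (K^[k] g) x * g x * w x ∂μ = C k :=
          integral_congr_ae (Eventually.of_forall fun x => by ring)
        rw [this, mul_comm]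
      have e2 : ∀ k ∈ Finset.range N,
          r ^ k * ∫ x, (K^[k] g) x * (K^[N] g) x * w x ∂μ = C (N + k) * r ^ k := by
        intro k _
        rw [two_time hAK hsymm hg k N, show k + N = N + k by ring, mul_comm]
      rw [Finset.sum_congr rfl e1, Finset.sum_congr rfl e2]
    rw [hB, hQS] at h
    exact h
  -- limits as `N → ∞`
  have hrN : Tendsto (fun N : ℕ => r ^ N) atTop (𝓝 0) := tendsto_pow_atTop_nhds_zero_of_lt_one hr0 hr1
  have hNrN : Tendsto (fun N : ℕ => (N : ℝ) * r ^ N) atTop (𝓝 0) :=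
    tendsto_self_mul_const_pow_of_lt_one hr0 hr1
  -- (i) `r^N I N → 0`
  have h1 : Tendsto (fun N : ℕ => r ^ N * I N) atTop (𝓝 0) := by
    refine squeeze_zero_norm (fun N => ?_) (by simpa using hrN.mul_const (Real.sqrt (P * D)))
    rw [norm_mul, norm_pow, Real.norm_eq_abs, Real.norm_eq_abs, abs_of_nonneg hr0]
    exact mul_le_mul_of_nonneg_left (hIabs N) (pow_nonneg hr0 N)
  -- (ii) `r^N Σ_{k<N} C(N+k) rᵏ → 0`
  have h2 : Tendsto (fun N : ℕ => r ^ N * ∑ k ∈ Finset.range N, C (N + k) * r ^ k) atTop (𝓝 0) := by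
    have hb : Tendsto (fun N : ℕ => P * ((N : ℝ) * r ^ N)) atTop (𝓝 0) := by
      simpa using hNrN.const_mul P
    refine squeeze_zero_norm (fun N => ?_) hb
    rw [norm_mul, norm_pow, Real.norm_eq_abs, Real.norm_eq_abs, abs_of_nonneg hr0]
    have hsum : |∑ k ∈ Finset.range N, C (N + k) * r ^ k| ≤ (N : ℝ) * P := by
      calc |∑ k ∈ Finset.range N, C (N + k) * r ^ k|
          ≤ ∑ k ∈ Finset.range N, |C (N + k) * r ^ k| := Finset.abs_sum_le_sum_abs _ _
        _ ≤ ∑ k ∈ Finset.range N, P := by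
            refine Finset.sum_le_sum fun k _ => ?_
            rw [abs_mul, abs_of_nonneg (pow_nonneg hr0 k)]
            calc |C (N + k)| * r ^ k ≤ P * 1 :=
                  mul_le_mul (hCabs _) (pow_le_one₀ hr0 hr1.le) (pow_nonneg hr0 k) hP0
              _ = P := mul_one P
        _ = (N : ℝ) * P := by simp
    calc r ^ N * |∑ k ∈ Finset.range N, C (N + k) * r ^ k| ≤ r ^ N * ((N : ℝ) * P) :=
          mul_le_mul_of_nonneg_left hsum (pow_nonneg hr0 N)
      _ = P * ((N : ℝ) * r ^ N) := by ring
  -- (iii) the partial Abel sums converge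
  have h3 : Tendsto (fun N : ℕ => ∑ k ∈ Finset.range N, C k * r ^ k) atTop
      (𝓝 (∑' k, C k * r ^ k)) :=
    (summable_autocov_mul_pow hw0 hAi hAK hcontr hg hr0 hr1).hasSum.tendsto_sum_nat
  have hL : Tendsto (fun N : ℕ => (I 0 - r ^ N * I N) ^ 2) atTop
      (𝓝 ((∫ x, g x * v x * w x ∂μ) ^ 2)) := by
    have := (tendsto_const_nhds (x := I 0)).sub h1
    rw [sub_zero, hI0] at this
    exact this.pow 2
  have hR : Tendsto (fun N : ℕ =>
      ((∑ k ∈ Finset.range N, C k * r ^ k) - r ^ N * ∑ k ∈ Finset.range N, C (N + k) * r ^ k) * Q)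
      atTop (𝓝 ((∑' k, C k * r ^ k) * Q)) := by
    have := (h3.sub h2).mul_const Q
    rw [sub_zero] at this
    exact this
  exact le_of_tendsto_of_tendsto' hL hR hstep

/-- **Normalised form**: with `C_g(0) = ∫ g² w > 0` and `ρ(k) = C_g(k)/C_g(0)`, for `0 ≤ r < 1` and
every trial observable `v ∈ A` with `Q_r(v) > 0`:
`Σ_{k≥0} ρ(k) rᵏ ≥ (∫ g v w)² / (C_g(0) · Q_r(v))`. -/
theorem abelSum_autocorr_ge_variational (hw0 : ∀ x, 0 ≤ w x)
    (hAi : ∀ ⦃f h : X → ℝ⦄, A f → A h → Integrable (fun x => f x * h x * w x) μ)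
    (hAc : ∀ ⦃f h : X → ℝ⦄ (c : ℝ), A f → A h → A (fun x => f x + c * h x))
    (hAK : ∀ ⦃f : X → ℝ⦄, A f → A (K f))
    (hlin : ∀ ⦃f h : X → ℝ⦄ (c : ℝ), A f → A h →
      ∀ x, K (fun s => f s + c * h s) x = K f x + c * K h x)
    (hsymm : ∀ ⦃f h : X → ℝ⦄, A f → A h →
      ∫ x, K f x * h x * w x ∂μ = ∫ x, f x * K h x * w x ∂μ)
    (hcontr : ∀ ⦃f : X → ℝ⦄, A f → ∫ x, K f x ^ 2 * w x ∂μ ≤ ∫ x, f x ^ 2 * w x ∂μ)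
    {g v : X → ℝ} (hg : A g) (hv : A v) {r : ℝ} (hr0 : 0 ≤ r) (hr1 : r < 1)
    (hP : 0 < ∫ x, g x ^ 2 * w x ∂μ)
    (hQ : 0 < (∫ x, v x ^ 2 * w x ∂μ) - r * ∫ x, v x * K v x * w x ∂μ) :
    (∫ x, g x * v x * w x ∂μ) ^ 2
        / ((∫ x, g x ^ 2 * w x ∂μ) * ((∫ x, v x ^ 2 * w x ∂μ) - r * ∫ x, v x * K v x * w x ∂μ))
      ≤ ∑' k, (∫ x, g x * (K^[k] g) x * w x ∂μ) / (∫ x, g x ^ 2 * w x ∂μ) * r ^ k := by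
  have h := sq_inner_le_abelSum_mul_quadForm hw0 hAi hAc hAK hlin hsymm hcontr hg hv hr0 hr1
  have e : ∑' k, (∫ x, g x * (K^[k] g) x * w x ∂μ) / (∫ x, g x ^ 2 * w x ∂μ) * r ^ k
      = (∑' k, (∫ x, g x * (K^[k] g) x * w x ∂μ) * r ^ k) / ∫ x, g x ^ 2 * w x ∂μ := by
    rw [← tsum_div_const]
    exact tsum_congr fun k => by ring
  rw [e, div_le_div_iff₀ (mul_pos hP hQ) hP]
  nlinarith [h, hP]

/-- **MADRAS–SLADE IN ABEL FORM (no summability, no `ρ(1) < 1`)**: for a reversible sampler on an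
admissible class, every `g ∈ A` with `C_g(0) > 0` and every `0 ≤ r < 1` satisfy
`Σ_{k≥0} ρ(k) rᵏ ≥ 1/(1 − r ρ(1))`.  (As `r ↑ 1` the right side is `1/(1 − ρ(1)) =
½ + (1 + ρ(1))/(2(1 − ρ(1)))`, the `τ_int + ½` of `RevOp.tauInt_ge`.) -/
theorem abelSum_autocorr_ge (hw0 : ∀ x, 0 ≤ w x)
    (hAi : ∀ ⦃f h : X → ℝ⦄, A f → A h → Integrable (fun x => f x * h x * w x) μ)
    (hAc : ∀ ⦃f h : X → ℝ⦄ (c : ℝ), A f → A h → A (fun x => f x + c * h x))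
    (hAK : ∀ ⦃f : X → ℝ⦄, A f → A (K f))
    (hlin : ∀ ⦃f h : X → ℝ⦄ (c : ℝ), A f → A h →
      ∀ x, K (fun s => f s + c * h s) x = K f x + c * K h x)
    (hsymm : ∀ ⦃f h : X → ℝ⦄, A f → A h →
      ∫ x, K f x * h x * w x ∂μ = ∫ x, f x * K h x * w x ∂μ)
    (hcontr : ∀ ⦃f : X → ℝ⦄, A f → ∫ x, K f x ^ 2 * w x ∂μ ≤ ∫ x, f x ^ 2 * w x ∂μ)
    {g : X → ℝ} (hg : A g) {r : ℝ} (hr0 : 0 ≤ r) (hr1 : r < 1)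
    (hP : 0 < ∫ x, g x ^ 2 * w x ∂μ) :
    1 / (1 - r * ((∫ x, g x * K g x * w x ∂μ) / ∫ x, g x ^ 2 * w x ∂μ))
      ≤ ∑' k, (∫ x, g x * (K^[k] g) x * w x ∂μ) / (∫ x, g x ^ 2 * w x ∂μ) * r ^ k := by
  set P := ∫ x, g x ^ 2 * w x ∂μ with hPdef
  set C1 := ∫ x, g x * K g x * w x ∂μ with hC1
  have hQ0 := quadForm_nonneg hw0 hAi hAK hcontr hg hr0 hr1.le
  have hC1le : C1 ≤ P := by
    have h := abs_autocov_le hw0 hAi hAK hcontr hg 1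
    simp only [Function.iterate_one] at h
    exact (le_abs_self _).trans h
  have hQ : 0 < P - r * C1 := by nlinarith
  have h := abelSum_autocorr_ge_variational hw0 hAi hAc hAK hlin hsymm hcontr hg hg hr0 hr1 hP hQ
  have hgg : ∫ x, g x * g x * w x ∂μ = P := integral_congr_ae (Eventually.of_forall fun x => by
    ring)
  rw [hgg] at h
  have hPne : P ≠ 0 := hP.ne'
  have hQne : P - r * C1 ≠ 0 := hQ.ne'
  have h1 : 1 - r * (C1 / P) = (P - r * C1) / P := by
    rw [sub_div, div_self hPne, mul_div_assoc]
  have e : 1 / (1 - r * (C1 / P)) = P ^ 2 / (P * (P - r * C1)) := by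
    rw [h1, one_div_div, div_eq_div_iff hQne (mul_ne_zero hPne hQne)]
    ring
  rw [e]
  exact h

end RevOp

end Summit.Ventures.LatticeQCDFlow.Exactness
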